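import Mathlib
import Summits.Ventures.PercRepro2.Defs
import Summits.Ventures.PercRepro2.Independence
import Summits.Ventures.PercRepro2.Harris

/-!
# The pinning induction for a covariance inequality: a safe edge at every state suffices (blind cell
PercRepro2, p4 g32; proofs/P4-G32-STRUCTURE.md §8–§9; P4-G31-CORNER.md §8 (SAFE))

For events `G, H, M, B` (any sets) and weights `p`, pinning an edge `e` splits the covariance defect
`Ψ_p := Cov_p(G, H) − Cov_p(M, B ∩ H)` as `Ψ_p = a·Ψ_{p[e↦1]} + (1 − a)·Ψ_{p[e↦0]} + a(1 − a)·T_p(e)` with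
the LOCAL TERM `T_p(e) := ΔG·ΔH − ΔM·Δ(B ∩ H)` (`ΔX := P_{p[e↦1]}(X) − P_{p[e↦0]}(X)`). An edge with
`T_p(e) ≥ 0` is SAFE. **`cov_inter_le_cov_of_safe`**: if every admissible weight vector that still has
an unpinned edge has a safe unpinned edge, then `Cov_p(M, B ∩ H) ≤ Cov_p(G, H)` for every admissible
`p` — by induction on the number of unpinned edges (a fully pinned `p` is a point mass, where every
covariance vanishes). The cell's three-event lemma `Cov(↑(G∩B), B∩H) ≤ Cov(G,H)` is the instance
`M = ↑(G ∩ B)`, and (SAFE) of P4-G31-CORNER §8 is the hypothesis `hsafe`.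
Two PROVED safe-edge rules for increasing `G, H, M` (§9): **`localTerm_nonneg_of_delta_inter_nonpos`**
(`Δ(B ∩ H) ≤ 0`) and **`localTerm_nonneg_of_deltaM_le_deltaG`** (`ΔM ≤ ΔG`, i.e. `Δ(G ∖ M) ≥ 0`).
No instance, no notation.
-/

namespace Summit.Ventures.PercRepro2

namespace ThreeEvent

section LocalTerm

variable {E : Type*} [Fintype E] [DecidableEq E] {R : Type*} [CommRing R]

/-- The pinning difference `ΔX = P_{p[e↦1]}(X) − P_{p[e↦0]}(X)`. -/
noncomputable def pinDelta (p : E → R) (e : E) (X : Set (Config E)) : R :=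
  prob (Function.update p e 1) X - prob (Function.update p e 0) X

/-- The local term of the pinning step: `T_p(e) = ΔG·ΔH − ΔM·Δ(B ∩ H)`. -/
noncomputable def localTerm (p : E → R) (e : E) (G H M B : Set (Config E)) : R :=
  pinDelta p e G * pinDelta p e H - pinDelta p e M * pinDelta p e (B ∩ H)

/-- The covariance defect `Ψ_p = Cov_p(G, H) − Cov_p(M, B ∩ H)`. -/
noncomputable def defect (p : E → R) (G H M B : Set (Config E)) : R :=
  (prob p (G ∩ H) - prob p G * prob p H) - (prob p (M ∩ (B ∩ H)) - prob p M * prob p (B ∩ H))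

/-- The covariance `P(X ∩ Y) − P(X) P(Y)`, pinned at an edge. -/
lemma cov_eq_pin_safe (p : E → R) (X Y : Set (Config E)) (e : E) :
    prob p (X ∩ Y) - prob p X * prob p Y =
      p e * (prob (Function.update p e 1) (X ∩ Y)
          - prob (Function.update p e 1) X * prob (Function.update p e 1) Y)
      + (1 - p e) * (prob (Function.update p e 0) (X ∩ Y)
          - prob (Function.update p e 0) X * prob (Function.update p e 0) Y)
      + p e * (1 - p e) * (pinDelta p e X * pinDelta p e Y) := by
  unfold pinDelta
  rw [prob_eq_pin p (X ∩ Y) e, prob_eq_pin p X e, prob_eq_pin p Y e]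
  ring

/-- **The pinning identity for the defect**:
`Ψ_p = p e · Ψ_{p[e↦1]} + (1 − p e) · Ψ_{p[e↦0]} + p e (1 − p e) · T_p(e)`. -/
theorem defect_eq_pin (p : E → R) (G H M B : Set (Config E)) (e : E) :
    defect p G H M B =
      p e * defect (Function.update p e 1) G H M B
        + (1 - p e) * defect (Function.update p e 0) G H M B
        + p e * (1 - p e) * localTerm p e G H M B := by
  unfold defect localTerm
  rw [cov_eq_pin_safe p G H e, cov_eq_pin_safe p M (B ∩ H) e]
  ring

end LocalTerm

section Induction

variable {E : Type*} [Fintype E] [DecidableEq E] {R : Type*} [CommRing R] [LinearOrder R]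
  [IsStrictOrderedRing R]

/-- A fully pinned weight vector is a point mass: every probability is `0` or `1`, so every
covariance vanishes. -/
lemma cov_eq_zero_of_pinned (p : E → R) (hpin : ∀ e, p e = 0 ∨ p e = 1) (X Y : Set (Config E)) :
    prob p (X ∩ Y) - prob p X * prob p Y = 0 := by
  obtain ⟨ω₀, h⟩ := exists_expect_eq_of_pinned p hpin
  simp only [prob_eq_expect_indicator, h]
  by_cases hX : ω₀ ∈ X <;> by_cases hY : ω₀ ∈ Y <;> simp [hX, hY]

/-- The defect of a fully pinned weight vector vanishes. -/
lemma defect_eq_zero_of_pinned (p : E → R) (hpin : ∀ e, p e = 0 ∨ p e = 1)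
    (G H M B : Set (Config E)) : defect p G H M B = 0 := by
  unfold defect
  rw [cov_eq_zero_of_pinned p hpin, cov_eq_zero_of_pinned p hpin, sub_zero]

/-- The unpinned edges of `p`. -/
def unpinned (p : E → R) : Finset E := Finset.univ.filter fun e => p e ≠ 0 ∧ p e ≠ 1

omit [Fintype E] in
/-- Pinning an unpinned edge removes it from the unpinned set and touches no other edge. -/
lemma unpinned_update [Fintype E] (p : E → R) {e : E} (he : e ∈ unpinned p) (q : R)
    (hq : q = 0 ∨ q = 1) : unpinned (Function.update p e q) = (unpinned p).erase e := by
  ext e'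
  simp only [unpinned, Finset.mem_filter, Finset.mem_univ, true_and, Finset.mem_erase]
  by_cases h : e' = e
  · subst h
    simp only [Function.update_self, ne_eq, not_true_eq_false, false_and, iff_false, not_and,
      not_not]
    rcases hq with hq | hq <;> simp [hq]
  · simp [h]

/-- **The pinning induction**: if every admissible weight vector with an unpinned edge has an
unpinned edge `e` with `T_p(e) ≥ 0`, then the defect is nonnegative for every admissible weight
vector, i.e. `Cov_p(M, B ∩ H) ≤ Cov_p(G, H)`. Induction on the number of unpinned edges. -/
theorem defect_nonneg_of_safe (G H M B : Set (Config E))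
    (hsafe : ∀ p : E → R, IsProbVec p → (unpinned p).Nonempty →
      ∃ e ∈ unpinned p, 0 ≤ localTerm p e G H M B) :
    ∀ p : E → R, IsProbVec p → 0 ≤ defect p G H M B := by
  classical
  intro p hp
  induction hn : (unpinned p).card using Nat.strong_induction_on generalizing p with
  | _ n ih =>
    by_cases hne : (unpinned p).Nonempty
    · obtain ⟨e, he, hT⟩ := hsafe p hp hne
      have ha0 : 0 ≤ p e := hp.nonneg e
      have ha1 : 0 ≤ 1 - p e := sub_nonneg.2 (hp.le_one e)
      have hcard : ((unpinned p).erase e).card < n := by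
        rw [← hn]; exact Finset.card_erase_lt_of_mem he
      have h1 : 0 ≤ defect (Function.update p e 1) G H M B :=
        ih _ hcard _ (hp.update e zero_le_one le_rfl) (by rw [unpinned_update p he 1 (Or.inr rfl)])
      have h0 : 0 ≤ defect (Function.update p e 0) G H M B :=
        ih _ hcard _ (hp.update e le_rfl zero_le_one) (by rw [unpinned_update p he 0 (Or.inl rfl)])
      rw [defect_eq_pin p G H M B e]
      have := mul_nonneg (mul_nonneg ha0 ha1) hT
      have := mul_nonneg ha0 h1
      have := mul_nonneg ha1 h0
      linarith
    · -- every edge is pinned: the defect vanishes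
      have hpin : ∀ e, p e = 0 ∨ p e = 1 := fun e => by
        by_contra hcon
        refine hne ⟨e, ?_⟩
        simp only [unpinned, Finset.mem_filter, Finset.mem_univ, true_and]
        exact ⟨fun h => hcon (Or.inl h), fun h => hcon (Or.inr h)⟩
      rw [defect_eq_zero_of_pinned p hpin]

/-- **A safe edge at every state suffices** (the conditional form of the three-event lemma):
`Cov_p(M, B ∩ H) ≤ Cov_p(G, H)` for every admissible `p`, under the hypothesis (SAFE) that every
admissible weight vector with an unpinned edge has an unpinned edge with nonnegative local term. -/
theorem cov_inter_le_cov_of_safe (G H M B : Set (Config E))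
    (hsafe : ∀ p : E → R, IsProbVec p → (unpinned p).Nonempty →
      ∃ e ∈ unpinned p, 0 ≤ localTerm p e G H M B)
    {p : E → R} (hp : IsProbVec p) :
    prob p (M ∩ (B ∩ H)) - prob p M * prob p (B ∩ H) ≤ prob p (G ∩ H) - prob p G * prob p H :=
  sub_nonneg.1 (defect_nonneg_of_safe G H M B hsafe p hp)

end Induction

section Rules

variable {E : Type*} [Fintype E] [DecidableEq E] {R : Type*} [CommRing R] [LinearOrder R]
  [IsStrictOrderedRing R]

/-- For an increasing event the pinning difference is nonnegative. -/
lemma pinDelta_nonneg {p : E → R} (hp : IsProbVec p) {X : Set (Config E)} (hX : IsUpperSet X)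
    (e : E) : 0 ≤ pinDelta p e X := by
  unfold pinDelta
  rw [sub_nonneg, prob_eq_expect_indicator, prob_eq_expect_indicator]
  exact expect_update_zero_le_expect_update_one hp (monotone_indicator_of_isUpperSet hX) e

/-- **Rule (R1)**: `Δ(B ∩ H) ≤ 0` makes the edge safe (for increasing `G, H, M`). -/
theorem localTerm_nonneg_of_delta_inter_nonpos {p : E → R} (hp : IsProbVec p)
    {G H M B : Set (Config E)} (hG : IsUpperSet G) (hH : IsUpperSet H) (hM : IsUpperSet M)
    (e : E) (hBH : pinDelta p e (B ∩ H) ≤ 0) : 0 ≤ localTerm p e G H M B := by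
  unfold localTerm
  have h1 := mul_nonneg (pinDelta_nonneg hp hG e) (pinDelta_nonneg hp hH e)
  have h2 : pinDelta p e M * pinDelta p e (B ∩ H) ≤ 0 :=
    mul_nonpos_of_nonneg_of_nonpos (pinDelta_nonneg hp hM e) hBH
  linarith

/-- `Δ(B ∩ H) ≤ ΔH` when `H ∖ B` is increasing, e.g. `B` decreasing: `ΔH − Δ(B ∩ H) = Δ(H ∖ B)`. -/
lemma pinDelta_inter_le_pinDelta {p : E → R} (hp : IsProbVec p) {H B : Set (Config E)}
    (hHB : IsUpperSet (H \ B)) (e : E) : pinDelta p e (B ∩ H) ≤ pinDelta p e H := by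
  have hsplit : ∀ q : E → R, prob q H = prob q (B ∩ H) + prob q (H \ B) := by
    intro q
    have := prob_inter_add_prob_inter_compl q H B
    rw [Set.inter_comm H B] at this
    rw [← this]
    rfl
  have hd : pinDelta p e H = pinDelta p e (B ∩ H) + pinDelta p e (H \ B) := by
    unfold pinDelta
    rw [hsplit (Function.update p e 1), hsplit (Function.update p e 0)]
    ring
  have := pinDelta_nonneg hp hHB e
  linarith

/-- **Rule (R2)**: `ΔM ≤ ΔG` makes the edge safe (for increasing `H, M` and `H ∖ B` increasing,
e.g. `B` decreasing): `T ≥ ΔM · Δ(H ∖ B) ≥ 0`. -/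
theorem localTerm_nonneg_of_deltaM_le_deltaG {p : E → R} (hp : IsProbVec p)
    {G H M B : Set (Config E)} (hH : IsUpperSet H) (hM : IsUpperSet M)
    (hHB : IsUpperSet (H \ B)) (e : E) (hMG : pinDelta p e M ≤ pinDelta p e G) :
    0 ≤ localTerm p e G H M B := by
  unfold localTerm
  have hM0 := pinDelta_nonneg hp hM e
  have hH0 := pinDelta_nonneg hp hH e
  have hBH := pinDelta_inter_le_pinDelta hp hHB e
  have h1 : pinDelta p e M * pinDelta p e H ≤ pinDelta p e G * pinDelta p e H :=
    mul_le_mul_of_nonneg_right hMG hH0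
  have h2 : pinDelta p e M * pinDelta p e (B ∩ H) ≤ pinDelta p e M * pinDelta p e H :=
    mul_le_mul_of_nonneg_left hBH hM0
  linarith

omit [Fintype E] [DecidableEq E] in
/-- `H ∖ B` is increasing when `H` is increasing and `B` decreasing. -/
lemma isUpperSet_diff_of_isLowerSet {H B : Set (Config E)} (hH : IsUpperSet H)
    (hB : IsLowerSet B) : IsUpperSet (H \ B) := by
  intro ω ω' h hω
  exact ⟨hH h hω.1, fun hω' => hω.2 (hB h hω')⟩

end Rules

end ThreeEvent

end Summit.Ventures.PercRepro2
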